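import Mathlib.NumberTheory.Padics.Complex
import Mathlib.RingTheory.FreeRing
import Mathlib.NumberTheory.NumberField.Discriminant.Defs
import Mathlib.NumberTheory.NumberField.InfinitePlace.TotallyRealComplex
import Literature.NumberTheory.Automorphic.CompletedCohomologyHeckeAlgebraGLn
import Literature.NumberTheory.Automorphic.ResGLnCohomology
import HarnessLib

/-!
# Torsion Hecke relations of the `p`-power tower of `GL₂` over a totally real field are
# classical modulo nilpotence (Scholze 2015, Thm. IV.3.1, for the `GL₂/F` tower; named fact)

Topic `NumberTheory/Automorphic`; namespace `Literature.NumberTheory.Automorphic`, grouping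
sub-namespace `BigHeckeGLn` (that of the tower: `TameLevel 2 F p`, its `p`-power levels
`𝒰.tower r = U_r`, the torsion modules `BigHeckeGLn.levelCohomology (𝒰.tower r) (ZMod (p^s)) i =
H^i(X_{U_r}, ℤ/p^s) := H^i(GL₂(F), Fun(GL₂(𝔸_F^∞)/U_r, ℤ/p^s))` and the double-coset operators
`𝒰.heckeOperator (heckeElement 2 F v i) (r,s,i) = T_{v,i}` on them,
`CompletedCohomologyHeckeAlgebraGLn.lean`); the classical side is the receptacle
`ResGLnCohomology.levelCohomology (PadicAlgCl p) 2 F 𝔫 λ q = H^q(S_{K_f(𝔫)}, Ẽ_λ(ℚ̄_p))` with its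
`ResGLnCohomology.heckeT … v i = T_{v,i}` (`ResGLnCohomology.lean`; same elements `t_{v,i}`, same
convention `(T f)(xK) = Σ_{yK ⊆ KtK} f(xyK)` on both sides).  ONE NAMED FACT (`def … : Prop`,
D-0014), in the lattice-free "relation currency" of its consumer:

* `BigHeckeGLn.Scholze2015_gl2TowerHeckeRelations_classical` — for `F` totally real, `p ≥ 5`
  unramified in `F` and an `S`-good level datum `𝒰 : TameLevel 2 F p`, there are a level `𝔫 ≠ 0`
  (depending only on `𝒰`) and an exponent `N ≥ 1` such that for every FINITE set `J` of tower
  indices `(r, s, i)` there are a `p`-exponent `e` and finitely many classical receptacles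
  `H^{q_k}(S_{K_f(𝔫p^e)}, Ẽ_{λ_k}(ℚ̄_p))` with PARALLEL weights `λ_k`, such that every INTEGER
  non-commutative polynomial relation `Q(T_{v_1,i_1}, …, T_{v_r,i_r}) = 0`
  (`Q ∈ ℤ⟨X_1,…,X_r⟩ = FreeRing (Fin r)`, letters at good places `v_j ∉ S`, `v_j ∤ 𝔫p`) holding on
  EVERY receptacle of the family holds modulo nilpotence of exponent `N` on the torsion modules:
  `Q(T_{v_1,i_1}, …, T_{v_r,i_r})^N = 0` on `H^i(X_{U_r}, ℤ/p^s)` for every `(r,s,i) ∈ J`.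
  In words: the image of the integer spherical Hecke algebra in `End(⊕_J H^i(X_{U_r}, ℤ/p^s))`
  is, modulo an ideal `I` with `I^N = 0`, a quotient of its image on finitely many spaces of
  classical Hilbert modular forms of level `K_f(𝔫p^e)` — "all Hecke eigenvalues appearing in
  `H̃^i` can be `p`-adically interpolated by Hecke eigenvalues coming from classical cusp forms"
  [Scholze2015, Introduction, Thm. 5], sharpened from eigenvalues to Hecke algebras as in
  loc. cit. Thm. IV.3.1, for the locally symmetric tower of `GL₂/F`.

## What is printed, and where

* Scholze 2015, **Thm. IV.3.1** (`(G, D)` of Hodge type, `K^p` inside the level-`N`-subgroup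
  of `Sp_{2g}(𝔸_f^p)` for some `N ≥ 3` prime to `p`, `𝕋 = 𝕋_{K^p} = ℤ_p[G(𝔸_f^p)//K^p]`): "Fix
  some integer `m ≥ 1`. Let `𝕋_cl` denote `𝕋` equipped with the weakest topology for which all
  the maps `𝕋 → End_C(H^0(𝒳*_{K_pK^p}, ω^{⊗mk} ⊗ ℐ))` are continuous, for varying `k ≥ 1` and
  `K_p ⊂ G(ℚ_p)`, where the right-hand side is a finite-dimensional `C`-vector space endowed with
  the `p`-adic topology. Then the map `𝕋_cl = 𝕋 → End_{ℤ/p^n}(H̃^i_{c,K^p}(ℤ/p^n))` is continuous"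
  (pointwise-discrete topology on the target; `H̃^i_{c,K^p}(ℤ/p^n) = colim_{K_p} H^i_c(X_{K_pK^p}, ℤ/p^n)`;
  the `H^0(…, ω^{⊗mk} ⊗ ℐ)` are the cusp forms of weight `mk`, §IV.3 before Lemma IV.3.2).
  Unwound: the annihilator of any finite subset of `H̃^i_c(ℤ/p^n)` contains `{T : T` integral and
  `p`-adically small on finitely many of these cusp-form spaces`}`, in particular every `T ∈ 𝕋`
  VANISHING on them.  Ch. IV uses no trace formula (the dependence on Arthur's work enters only
  in Ch. V, Thm. V.1.4 / Rem. V.4.6), and "Theorem IV.1.1 (and all results in Chapter IV deduced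
  from it) stays true verbatim for usual Shimura varieties of Hodge type (with the same proof)"
  [Scholze2015, Rem. V.4.6].  The proof (§IV.3): by Thm. IV.2.1,
  `H̃^i_c(ℤ/p^n) ⊗ 𝒪_C/p^n ≅ᵃ H^i(𝒳*_{K^p}, ℐ⁺ᵃ/p^n)`, computed by the Čech complex of the cover
  `𝒱_J = π_HT⁻¹(𝒰_J)`, `𝒰_i = {|s_j| ≤ |s_i| ∀ j}` in Plücker coordinates, "all `𝒱_J` are stable
  under the action of the Hecke operators away from `p`. Thus `𝕋` acts on each term of the Čech
  complex individually", and on each term the action factors through cusp forms of large weight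
  (fake Hasse invariants `s̄_j`, Lemma IV.3.3, ampleness).
* Scholze 2015, **Cor. IV.2.2** (`H̃^i_{c,K^p}(ℤ/p^n) = 0` for `i > d = dim`) and the **proof of
  Cor. V.2.6**: at FINITE level `K_p`, "one has the Hochschild–Serre spectral sequence
  `H^i_cont(K_{S}/K^p_{S}, H̃^j_c(ℤ/p^m)) ⇒ H^{i+j}_c(X_K, ℤ/p^m)` … `𝕋_cl` acts continuously on the
  `E_2`-term … so that there is a filtration of `H^i_c(X_K, ℤ/p^m)` by at most `d+1` terms such
  that the associated action on the graded quotients is continuous. Let `J` be the ideal of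
  elements acting trivially on the associated graded quotients. Then `J^{d+1} = 0`" — the source
  of the nilpotence, with exponent depending only on the dimension ("we do not strive to give the
  best bound on the nilpotence degree", before that proof).
* Scholze 2015, **§V.4**: `X_K = GL_n(F)\[(GL_n(F ⊗ ℝ)/ℝ_{>0}K_∞) × GL_n(𝔸_{F,f})/K]`, "If `K` is not
  sufficiently small, we regard this as a 'stacky' object", and the proof of Thm. V.4.1: the
  Hochschild–Serre spectral sequence for `K' ⊂ K` normal "reduces us to the case that `K` is
  sufficiently small", then "Using the Borel–Serre compactification `X_K^{BS}`, we have the long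
  exact sequence `… → H^i_c(X_K) → H^i(X_K) → H^i(X_K^{BS} ∖ X_K) → …`. It is an easy exercise to
  express `H^i(X_K^{BS} ∖ X_K)` in terms of the locally symmetric spaces for `GL_{n'}/F`,
  `n' < n`".  The tree's `BigHeckeGLn.levelCohomology` IS the cohomology of this stacky `X_K`
  (group cohomology of `GL_n(F)` in `Fun(GL_n(𝔸_{F,f})/K, ·)`, the symmetric space
  `GL₂(F ⊗ ℝ)/ℝ_{>0}K_∞ ≅ ℍ^g × ℝ^{g−1}` being contractible), [Scholze2015, §V.4] being the cite of
  that definition (`CompletedCohomologyHeckeAlgebraGLn.lean`).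
* Newton–Thorne 2016, **§3.1 (`X_G^U`, neat `U`), §3.1.2 Prop. 3.8–Cor. 3.9, §4, proof of
  Thm. 4.2 with Lemmas 4.3–4.5** (`G = GL_n` over ANY number field; `X_G` the space of type
  `S–ℚ`, which for `Res_{F/ℚ}GL_n` is `GL_n(F⊗ℝ)/K_∞ℝ^×`, Scholze's; coefficients any finite
  `𝒪[U_S]`-module): the `𝕋^S`-complex of the Borel–Serre boundary stratum of a standard parabolic
  `P = MN` is quasi-isomorphic to (a finite sum of) `𝒮^*(RΓ(X_M^{U_M}, A_M))`, `𝒮 = r_M ∘ r_P` the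
  unnormalised Satake transform and `A = H^i(U_{N,S}, k)` with `U_{M,S}` acting by conjugation
  ("Let us now take stock …" in the proof of Thm. 4.2; Prop. 3.8 / Cor. 3.9: "restriction of Hecke
  action to the boundary"; Lemma 4.3: "we can find a normal subgroup `U' ⊂ U` such that `U'_S` acts
  trivially on `A` … spectral sequence"; the Galois-type hypothesis ♠ of Thm. 4.2 enters only
  afterwards, to name the Levi eigensystems Eisenstein, and is not used here).  For `n = 2`,
  `M = T = GL₁ × GL₁`, `X_T^{U_T}` is a finite union of compact tori indexed by a product of two
  narrow ray-class-type groups `A_T = T(F)\T(𝔸_{F,f})π₀(T_∞)/U_T`, and `𝕋^S_T` acts on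
  `H^*(X_T^{U_T}, ℤ/p^m) = (ℤ/p^m)[A_T] ⊗ Λ^*` through the group ring: EXACT control by the joint
  relations of ALL characters of the finite abelian group `A_T` (they separate `ℚ̄_p[A_T]`).
* Harder 1987, **§2.6 Thm. 1 and §4.2 Thm. 2** (`G = Res_{F/ℚ}GL₂`, any number field, any
  coefficient system): `H^•(∂S_K, M̃) = ⊕_w ⊕_φ Ind φ_f` over the algebraic Hecke characters `φ` of
  the split torus of the types `w·λ`, with unramified eigensystems `𝒮^*(φ)`; `H^•(S_K, M̃_ℂ) =
  H^•_! ⊕ H^•_Eis`, `H^•_Eis ≅ Im(H^• → H^•(∂S_K, M̃))` spanned by Eisenstein classes, every boundary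
  eigensystem being attained (the classes of `φ` and of its `w₀`-partner have the same
  eigensystem and one of the two lies in the image).  With `M = ℚ` and `K = K_f(𝔫')` every
  character of `A_T` of level `K_f(𝔫') ∩ T` (finite order, all sign types) is such a `φ` of type
  `w = 1`: the receptacles `H^q(S_{K_f(𝔫')}, ℚ̄_p)`, all `q`, jointly carry all of them.
* Caraiani–Tamiozzo 2023, **§2.1.1–§2.1.3** (`Sh_K(G)(ℂ) = G(ℚ)\X × G(𝔸_f)/K`, `X = (ℂ∖ℝ)^g`;
  Lemma of §2.1.3: `X_K(G) → Sh_K(G)` is a `T_K`-bundle, `T_K = Z(ℝ)/{±1}^gℝ_{>0}Z_K` a torus of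
  dimension `g − 1` (Graf); for `ℓ` odd and `det K = K ∩ Z(𝔸_f)` the pullback
  `H^i(Sh_K(G), 𝔽_ℓ) → H^i(X_K(G), 𝔽_ℓ)` is injective by Leray–Hirsch with global classes;
  `X̄_K(G) = X_K(G)/C`, `C = (ℤ/2)^g`, "the space used in [Sch15]", `H^*(X̄_K) = H^*(X_K)^{Id}`)
  and **§2.2, Remark after Thm. 2.2.1**: "One could prove the above result by adapting the
  arguments in Chapter IV of [Sch15]. The main technical point one needs to deal with is the
  construction of ad hoc compactifications of Hilbert modular varieties [footnote: This is
  slightly subtle because Hilbert modular varieties are Shimura varieties of abelian type and do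
  not directly embed into Siegel modular varieties. However, one can handle this issue by
  carefully choosing the tame level.]".
* Emerton–Reduzzi–Xiao 2017, **§2.1 (2.1)–(2.3), §2.1.1 and §2.2.2** (`F` totally real, `g > 1`,
  `p` unramified, narrow class representatives `𝔠` prime to `p`): the Shimura variety of
  `Res_{F/ℚ}GL₂` is `Sh = ∐_𝔠 Sh_𝔠`, `Sh_𝔠 = ℳ_𝔠/(𝒪_F^{×,+}/(𝒪^×_{F,N})²)`, the fine moduli scheme `ℳ_𝔠`
  of `𝔠`-polarised Hilbert–Blumenthal abelian schemes with level structure — a PEL moduli space,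
  a union of components of Shimura varieties of the Hodge-type datum
  `G* = GL₂ ×_{Res 𝔾_m} 𝔾_m` — modulo the free action (for `N` sufficiently divisible) of a finite
  `2`-group of units on polarisations; the Hecke correspondence `T_𝔞` of `Sh` is the isogeny
  correspondence `ℳ_𝔠(𝔞) → ℳ_{𝔠'}` of the fine moduli composed with a totally positive isomorphism
  `θ_𝔠 : 𝔞𝔠 ≅ 𝔠'` (after Kisin–Lai, 1.9–1.11).
* Classical cusp forms `↦` Betti classes: a cuspidal Hilbert eigenform of parallel weight
  `2k ≥ 2` and level `K' ⊇ K_f(𝔫p^e)` gives a non-zero eigenclass, with the same good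
  `T_{v,i}`-eigenvalues, in `H^g(S_{K_f(𝔫p^e)}, Ẽ_λ(ℚ̄_p))`, `λ_τ = (2k−2, 0)` for all `τ`
  (Eichler–Shimura–Harder; Clozel Lemme 3.15 = the tree's named fact
  `ResGLnCohomology.cuspidalEigenclass_exists`, `ResGLnCuspidalEigenclass.lean`); since the
  cusp-form spaces are semisimple Hecke modules (Petersson; [Scholze2015, Cor. V.1.7, proof]) and
  all their eigensystems so occur, a relation on the receptacle is a relation on them.

## From print to the statement (the assembly, every step named)

Fix `F, p, 𝒰` as in the statement; `g = [F:ℚ]`, `S = 𝒰.bad ⊇ {v ∣ p}`, `U = 𝒰.subgroup ⊇ K_f(𝔣)`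
for some `𝔣 ≠ 0` supported on `S` (`U` is open and hyperspecial off `S`), `U_r = 𝒰.tower r`.
(a) AUXILIARY LEVEL.  As `p ∤ disc F`, the Galois closure `F̃` meets `ℚ(ζ_p)` in `ℚ`, and as
`p ≥ 5`, `(ℤ/p)^× ≠ {±1}`; by Chebotarev in `F̃(ζ_p)/ℚ` there is a rational prime `ℓ ≥ 5`, `ℓ ≠ p`,
split completely in `F`, below no place of `S`, with `ℓ ≢ ±1 mod p`.  Put `𝔫 = 𝔣^{(p)} · ℓ𝒪_F`
(`𝔣^{(p)}` the prime-to-`p` part) and `U♭_r = U_r ∩ K(ℓ)`: the index `[U_r : U♭_r] = |GL₂(𝔽_ℓ)|^g`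
is prime to `p`, so `H^*(X_{U_r}, ℤ/p^s)` is the `U_r/U♭_r`-invariants, a Hecke-equivariant (for
`v ∉ S`, `v ∤ ℓ` — the letters of the statement) direct summand, of `H^*(X_{U♭_r}, ℤ/p^s)`;
`U♭_r` is neat (Pink's condition at a prime above `ℓ ≥ 5` unramified over `ℓ`), its `G*`-parts lie in
the principal level-`ℓ` subgroup (`N = ℓ ≥ 3` in Thm. IV.1.1), `X_{U♭_r}` is a manifold of dimension
`3g − 1`, and `K_f(𝔫p^e) ⊆ U♭_r` for `e ≥ e₀(𝒰) + r`.
(b) BOREL–SERRE (Scholze §V.4; Newton–Thorne).  `H^i(X_{U♭_r})` is an extension of a submodule of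
`H^i(∂X^{BS}_{U♭_r})` by a quotient of `H^i_c(X_{U♭_r})`.  The boundary term is, through finite
filtrations of length bounded in terms of `g` (strata; the nilmanifold fibration; Hochschild–Serre
from `U♭_T` to its level-`p^e` subgroup, `e ≥ s`, trivialising the conjugation action on
`H^*(U_{N,p}, ℤ/p^s)`), a `𝕋^S`-subquotient of sums of `𝒮^*((ℤ/p^s)[A_T] ⊗ Λ^*)` for the finite group
`A_T` of level `K_f(𝔫p^e) ∩ T`, on which every integer relation of the receptacles
`H^q(S_{K_f(𝔫p^e)}, ℚ̄_p)`, all `q` (weight `λ = 0`), acts by ZERO (Harder: all characters of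
`A_T` occur; characters separate the group ring).
(c) TORUS BUNDLE (Caraiani–Tamiozzo).  `X_{U♭_r}` is the tree's = Scholze's space, i.e. `X̄_K(G)`,
`K = U♭_r`; for `p` odd `H^*_{(c)}(X̄_K, ℤ/p^s) = H^*_{(c)}(X_K(G), ℤ/p^s)^C`, and `X_K(G) → Sh_K(G)` is
a principal bundle under the compact torus `T_K` on which `C` and the Hecke correspondences at
good places act through the base (the unit lattice `Z(F) ∩ K` is the same for `K` and
`K ∩ tKt⁻¹`), so Leray–Hirsch with the `det^*`-classes gives `H^*_{(c)}(X_K(G)) ≅ H^*_{(c)}(Sh_K(G)) ⊗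
H^*(T_K)` with `T_{v,i} ⊗ id`: the modules of (b) are Hecke direct summands of
`H^*_{(c)}(Sh_K(G), ℤ/p^s) ⊗ Λ^*`.
(d) `G` VERSUS `G*` (Emerton–Reduzzi–Xiao).  Global units `η ∈ 𝒪_F^× ⊂ Z(ℚ)` act trivially on
`Sh_K(G)`, so `Sh_K(G) = Sh_{𝒪_F^×K}(G)`; a connected component `Γ̄_c\ℍ^g`
(`c ∈ π₀ = F^×_+\𝔸^×_{F,f}/det K`, `Γ_c = GL₂(F) ∩ g_cKg_c⁻¹`, `det g_c = c`) is the quotient of the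
component `Γ*_c\ℍ^g`, `Γ*_c = SL₂(F) ∩ 𝒪_F^×·g_cKg_c⁻¹`, of the Shimura variety of the Hodge-type (PEL)
datum `(G*, X)`, `G* = GL₂ ×_{Res 𝔾_m} 𝔾_m`, at the tame level `K*_c = G*(𝔸_f) ∩ 𝒪_F^×·g_cKg_c⁻¹`, by the
FREE action of the finite `2`-group `Δ_c = det(Γ_c)/(det(Γ_c) ∩ 𝒪_F^{×2}) ⊆ 𝒪_F^{×,+}/𝒪_F^{×2}` (ERX's unit
quotient), acting through elements `γ ∈ Γ_c ⊂ G(ℚ)` — automorphisms `c_γ` of the datum `(G*, X)` with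
`γ_p ∈ K_p`.  For `p` odd the `G`-modules (torsion cohomology with or without supports, cusp forms)
are the `Δ_c`-invariants, images of the idempotents `e_Δ ∈ ℤ_p[Δ_c]`.  Choosing the
representatives `g_c` trivial at `p` (weak approximation), a `G`-Hecke operator `[KtK]`,
`t ∈ GL₂(𝔸^{S∪ℓ}_{F,f})`, lifts, block by block between these `G*`-varieties, to an element of the
algebra `𝒜` generated by the `G*(𝔸_f)`-Hecke operators between the tame levels `K*_c`
(trace ∘ translation ∘ restriction) and the isomorphisms of Shimura data
`c_γ : [x, y] ↦ [γx, γyγ⁻¹]`, `γ ∈ G(ℚ)⁺` with `γ_p ∈ GL₂(𝒪_{F,p})`, `γ_p ≡ 1 mod p^r` along the tower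
(`r ≥ 1`; ERX's `θ_𝔠 : 𝔞𝔠 ≅ 𝔠'` after absorbing unit squares into `G*(ℚ)` and `Z(ℚ)`); the level `r = 0`
is reached from `r = 1` by one more Hochschild–Serre spectral sequence (filtration of length `≤ 3g`).
If an integer polynomial `Q` in `G`-operators kills the `G`-cusp forms `(M*)^Δ`, then
`e_Δ Q(T̃) e_Δ ∈ 𝒜 ⊗ ℤ_p` kills ALL the `G*`-cusp forms `M*`.
(e) SCHOLZE.  Thm. IV.3.1, with `m = 2` (parallel weights `2k ≥ 2`), for the Hodge-type varieties
of (d): an integer Hecke operator vanishing on the cusp forms `H^0(𝒳*_{K_pK^p}, ω^{⊗2k} ⊗ ℐ)` of the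
finitely many `(k, K_p)` of a basic neighbourhood acts by `0` on `H̃^i_c(ℤ/p^n)`, hence
(Cor. V.2.6, proof) on the graded pieces of a `≤ g+1`-step filtration of `H^i_c` at finite
`p`-level.  The proof applies VERBATIM to the elements of `𝒜`: Hecke operators between two tame
levels are composites of the restriction/translation/trace maps of Thm. IV.2.1 and Lemma IV.3.3
(this is how `𝕋` acts in loc. cit.), and `c_γ` with `γ_p ≡ 1 mod p` acts on the Plücker coordinates
through an element of `GL(Λ ⊗ ℤ_p)` congruent to `1 mod p`, hence PRESERVES each affinoid `𝒰_i`
(`|s_j∘γ − s_j| ≤ |p| max_k |s_k| < |s_i|` on `𝒰_i`) and each `𝒱_J`, and multiplies the fake Hasse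
invariants by units `≡ 1` — so `e_Δ Q(T̃) e_Δ` kills the graded pieces, and `Q(T)` lowers the induced
filtration of the `Δ`-invariants.  THIS equivariance, i.e. Ch. IV for the Hilbert modular
varieties of the abelian-type group `Res_{F/ℚ}GL₂`, is asserted but not written out in print
[CaraianiTamiozzo2023, §2.2, Remark]; see "Status".
(f) RECEPTACLES.  The cusp forms of (e) (levels `K^pK_p ⊇ K_f(𝔫p^e)` for `e` large; finitely many
`(k, K_p)`) embed Hecke-equivariantly at the good places into `H^g(S_{K_f(𝔫p^e)}, Ẽ_{λ_k}(ℚ̄_p))`,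
`λ_k` parallel (Eichler–Shimura–Harder), so an integer relation on the receptacles of the statement
is a relation on them; with (b) the family is: these `H^g`'s and `H^q(S_{K_f(𝔫p^e)}, ℚ̄_p)`,
`0 ≤ q ≤ 3g − 1`.
(g) EXPONENT.  The filtrations of (a)–(f) have total length bounded in terms of `g` alone; an
integer relation acts trivially on every graded piece, so its `N`-th power vanishes, `N = N(g)` —
uniform in `J`, as the consumer needs (cf. [Scholze2015, Thm. V.4.1]: "`N = N([F:ℚ], n)` depending
only on `[F:ℚ]` and `n`").

## Status (read before reviewing)

CONSEQUENCE FORM, for the tree's `GL₂/F` tower, of a published and unconditional theorem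
(Scholze's Thm. IV.3.1), through the assembly (a)–(g).  Steps (a)–(d), (f), (g) are routine and
cited.  Step (e) applies Thm. IV.3.1 to the PEL Hilbert–Blumenthal moduli spaces (Hodge type,
covered verbatim by [Scholze2015, Rem. V.4.6]) and uses that its proof is equivariant for the
polarisation-changing isomorphisms `c_γ`, `γ_p ≡ 1 mod p`, through which the Hecke operators
and the unit groups of `Res_{F/ℚ}GL₂` act on those pieces — the adaptation flagged in
[CaraianiTamiozzo2023, §2.2, Remark] ("One could prove the above result by adapting the arguments
in Chapter IV of [Sch15] … by carefully choosing the tame level"), whose authors instead take the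
existence of Galois representations from Ch. V.  We know of no other printed route to the
classicality of deep-`p`-level torsion classes of Hilbert modular varieties (Emerton–Reduzzi–Xiao
treat COHERENT cohomology at level prime to `p`; torsion-freeness results of Dimitrov and Lan–Suh
need hyperspecial level at `p`).  The fact is therefore recorded as Scholze's theorem in the form
in which the literature uses it for `GL₂` over totally real fields, with this one adaptation made
explicit, and it is consumed only as a hypothesis
`(h : BigHeckeGLn.Scholze2015_gl2TowerHeckeRelations_classical)`: by the crux
`EisensteinGelfandKirillov.CrystallineProModularClassical` (stmt-Langlands-18274), line
`torsion-weight-exchange`, stub S2' `stub_tameLevelStripping` (torsion-to-classical level stripping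
at level `𝔫p^r`, `r` growing with the precision), together with the rationality fact
`ResGLnCohomology.heckeRelations_definedOverInt` (`ResGLnCohomologyRationalRelations.lean`), which
bridges the integer polynomials here to the `ℚ̄_p`-integral relation currency of that line.

## Lean rendering and design

* RELATION CURRENCY, no points, no eigenvectors: integer non-commutative polynomials
  `Q : FreeRing (Fin r)` (Mathlib) evaluated by `FreeRing.lift` — on the classical side in
  `Module.End ℚ̄_p (levelCohomology …)` at the letters `heckeT (PadicAlgCl p) 2 F (𝔫p^e) λ_k q_k v_j i_j`,
  on the torsion side in the product ring `𝒰.bigEnd = ∏_{(r,s,i)} End(H^i(X_{U_r}, ℤ/p^s))` at the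
  families `𝒰.heckeOperator (heckeElement 2 F v_j i_j)` (= `(𝒰.heckeT v_j i_j : 𝒰.bigEnd)` by
  `TameLevel.coe_heckeT`), the `N`-th power being read in the factors indexed by `J`.  This is
  Scholze's integer Hecke algebra `𝕋` on both sides; `p`-adic smallness is weakened to vanishing.
* `∃ 𝔫 ≠ 0` FIRST (tame level: prime-to-`p` conductor of `U` times the auxiliary `ℓ` of (a); the
  letters avoid `𝒰.bad` and the divisors of `𝔫p^e`, exactly the guard of the consumer's
  `FactorsThroughClassicalModP`), then `∃ N, 0 < N` UNIFORM in `J` ((g); `0 < N` excludes the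
  degenerate reading `T^0 = 1`), then `∀ J ∃ e` (the `p`-level grows with the depth `s` and the
  level `r` of the torsion modules: (b), (e)), then the finite PARALLEL family
  (`∀ k τ τ', lams k τ = lams k τ'`: Scholze's `ω^{⊗2k}` are parallel; Eisenstein receptacles have
  `λ = 0`), `m ≥ 1` being forced whenever some `H^i(X_{U_r}, ℤ/p^s)`, `(r,s,i) ∈ J`, is non-zero
  (with the empty family every `Q`, e.g. `Q = 1`, would be a relation): non-vacuity is built in.
* Hypotheses `IsTotallyReal F` (Hilbert modular varieties; FALSE for imaginary quadratic `F`: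
  completed cohomology of Bianchi manifolds is not exhausted by classical forms, Calegari–Mazur),
  `5 ≤ p`, `p ∤ disc F` (used in (a): `F̃ ∩ ℚ(ζ_p) = ℚ` and `(ℤ/p)^× ≠ {±1}` give the auxiliary prime
  `ℓ ≢ ±1 mod p` of prime-to-`p` index; and `p` odd throughout: `C = (ℤ/2)^g`, transfer) — the
  hypotheses of the consumer; Scholze's theorem itself needs none of them.  TODO(general form): `GL_n` over CM/totally real `F` (Scholze Ch. V gives
  Galois determinants, not classicality, for `n > 2`), arbitrary `p`, the `p`-adic (not only
  exact) neighbourhoods of Thm. IV.3.1, explicit `N`.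
* Sanity check `F = ℚ` (`g = 1`): `X_U` is an open modular curve, `H^1(Y(U_r), ℤ/p^s) =
  H^1(Y(U_r), ℤ) ⊗ ℤ/p^s` (no `H^2`), whose Hecke algebra is a quotient of the weight-`2` Hecke
  algebra of level `U_r ⊇ K_f(𝔫p^e)` acting on `H^1(S_{K_f(𝔫p^e)}, ℚ̄_p)` (Eichler–Shimura,
  Eisenstein classes included), and `H^0` is the group ring of the component group: the statement
  holds with `N = 1`, `λ = 0`.  For `g ≥ 2` torsion classes are genuinely new and `N > 1` is needed
  (non-semisimple torsion Hecke modules).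
* `lean search 'IV.3.1\|classical cusp forms\|interpolat'`: in the tree only the converse
  direction (classical / algebraic-weight points ARE continuous points of `𝕋(K^p)`:
  `AlgebraicWeight*`, `TameLevelHeckeNilpotent`, `RegularAlgebraicCuspidalHeckePoint*`) and the
  Galois side (`Scholze2015_galoisRep_of_modPEigensystem`, `TameLevel.residualRep_exists`,
  `TameLevel.bigGaloisRep_modNilpotent_exists`); nothing from torsion to classical.

## References

* P. Scholze, *On torsion in the cohomology of locally symmetric varieties*, Ann. of Math. 182
  (2015) 945–1066 = arXiv:1306.2070: Introduction Thm. 5; Thm. IV.1.1, Thm. IV.2.1, Cor. IV.2.2,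
  Thm. IV.3.1, Lemma IV.3.3; Cor. V.2.6 (proof); §V.4, Thm. V.4.1 (proof), Rem. V.4.6 (held; read
  2026-08-17). [Scholze2015]
* J. Newton, J. A. Thorne, *Torsion Galois representations over CM fields and Hecke algebras in
  the derived category*, Forum Math. Sigma 4 (2016) e21 = arXiv:1511.04913: §3.1, §3.1.2
  Prop. 3.8–Cor. 3.9, §4 Thm. 4.2, Lemmas 4.3–4.4 (held; read 2026-08-17). [NewtonThorne2016]
* G. Harder, *Eisenstein cohomology of arithmetic groups. The case GL₂*, Invent. Math. 89 (1987),
  §2.6 Thm. 1, §4.2 Thm. 2. [Harder1987]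
* M. Emerton, D. Reduzzi, L. Xiao, *Galois representations and torsion in the coherent
  cohomology of Hilbert modular varieties*, J. reine angew. Math. 726 (2017) = arXiv:1307.8003,
  §2.1 (2.1)–(2.3), §2.1.1, §2.2.2 (held; read 2026-08-17). [EmertonReduzziXiao2017]
* A. Caraiani, M. Tamiozzo, *On the étale cohomology of Hilbert modular varieties with torsion
  coefficients*, Compos. Math. 159 (2023) 2279–2325 = arXiv:2107.10081, §2.1.1–§2.1.3, §2.2
  (Thm. and Remark) (held; read 2026-08-17). [CaraianiTamiozzo2023]
* L. Clozel, *Motifs et formes automorphes* (1990), Lemme 3.15, §3.5. [Clozel1990]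
-/

noncomputable section

open scoped NumberField
open IsDedekindDomain NumberField

namespace Literature.NumberTheory.Automorphic

namespace BigHeckeGLn

/-- NAMED FACT — **torsion Hecke relations of the `p`-power tower of `GL₂` over a totally real
field are classical modulo nilpotence (Scholze's Thm. IV.3.1 for the `GL₂/F` tower, in relation
currency).**  For `F` totally real, `p ≥ 5` with `p ∤ disc F`, and an `S`-good level datum
`𝒰 : TameLevel 2 F p`: there are a level `𝔫 ≠ 0` and an exponent `N ≥ 1` such that for every finite
set `J` of tower indices `(r, s, i)` there are `e` and finitely many receptacles
`H^{q_k}(S_{K_f(𝔫p^e)}, Ẽ_{λ_k}(ℚ̄_p)) = ResGLnCohomology.levelCohomology (PadicAlgCl p) 2 F (𝔫p^e) λ_k q_k`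
with PARALLEL weights (`λ_k τ = λ_k τ'`), with the property: for letters `X_j ↦ (v_j, i_j)`,
`v_j ∉ 𝒰.bad`, `v_j ∤ 𝔫p^e`, every integer non-commutative polynomial `Q ∈ ℤ⟨X_1,…,X_r⟩` with
`Q(T_{v_1,i_1},…,T_{v_r,i_r}) = 0` on EVERY receptacle (`ResGLnCohomology.heckeT`) satisfies
`Q(T_{v_1,i_1},…,T_{v_r,i_r})^N = 0` on `H^i(X_{U_r}, ℤ/p^s)` for every `(r,s,i) ∈ J` (the
`(r,s,i)`-component of the `N`-th power of `FreeRing.lift (𝒰.heckeOperator ∘ heckeElement) Q` in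
`𝒰.bigEnd`).  Printed: for a Shimura datum of Hodge type the integer Hecke algebra acts on
`H̃^i_c(ℤ/p^n)` continuously for the topology defined by finitely many spaces of classical cusp
forms `H^0(𝒳*_{K_pK^p}, ω^{⊗mk} ⊗ ℐ)` [cite: Scholze2015, Thm. IV.3.1], verbatim for usual Hodge-type
varieties [cite: Scholze2015, Rem. V.4.6], at finite `p`-level through a filtration of `≤ d+1` steps
whose graded pieces it respects, `J^{d+1} = 0` [cite: Scholze2015, Cor. IV.2.2 and Cor. V.2.6 (proof)];
`X_K` is the stacky quotient whose cohomology is the tree's `levelCohomology`, reduced to small level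
and to the Borel–Serre boundary as in [cite: Scholze2015, §V.4, Thm. V.4.1 (proof)]; the boundary
is Eisenstein, its Hecke action factoring through the Levi torus via the unnormalised Satake
transform after a Hochschild–Serre reduction to constant coefficients
[cite: NewtonThorne2016, §3.1.2 Prop. 3.8 and §4 Thm. 4.2, Lemmas 4.3–4.4], and carried by
Eisenstein classes of level `K_f(𝔫p^e)` [cite: Harder1987, §4.2 Thm. 2]; the tower maps to the
Hilbert modular variety by a unit-torus bundle with Leray–Hirsch classes
[cite: CaraianiTamiozzo2023, §2.1.3 (Lemma)], the latter is the union of the fine PEL moduli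
spaces `ℳ_𝔠` modulo free actions of finite `2`-groups of units (invariants = images of idempotents,
`p` odd) with Hecke correspondences the `𝔠`-changing isogeny correspondences
[cite: EmertonReduzziXiao2017, §2.1.1 and §2.2.2], to which Thm. IV.3.1 and its proof apply
("One could prove … by adapting the arguments in Chapter IV of [Sch15]"
[cite: CaraianiTamiozzo2023, §2.2 (Remark)]); cusp forms of parallel weight `2k` give
eigenclasses in `H^g(S_{K_f(𝔫p^e)}, Ẽ_λ)` [cite: Clozel1990, Lemme 3.15].  CONSEQUENCE FORM with one
adaptation not written out in print (module docstring, "Status" and steps (a)–(g)); unproved in the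
tree; users take `(h : BigHeckeGLn.Scholze2015_gl2TowerHeckeRelations_classical)`. -/
def Scholze2015_gl2TowerHeckeRelations_classical : Prop :=
  ∀ (F : Type) [Field F] [NumberField F], IsTotallyReal F →
  ∀ (p : ℕ) [Fact p.Prime], 5 ≤ p → ¬ ((p : ℤ) ∣ NumberField.discr F) →
  ∀ (𝒰 : TameLevel 2 F p),
  ∃ 𝔫 : Ideal (𝓞 F), 𝔫 ≠ 0 ∧ ∃ N : ℕ, 0 < N ∧
  ∀ J : Finset (ℕ × ℕ × ℕ),
  ∃ (e m : ℕ) (lams : Fin m → (F →+* PadicAlgCl p) → Fin 2 → ℤ) (qs : Fin m → ℕ),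
    (∀ (k : Fin m) (τ τ' : F →+* PadicAlgCl p), lams k τ = lams k τ') ∧
    ∀ (r : ℕ) (ix : Fin r → HeightOneSpectrum (𝓞 F) × ℕ),
      (∀ j, (ix j).1 ∉ 𝒰.bad ∧ ¬ (ix j).1.asIdeal ∣ 𝔫 * Ideal.span {((p : ℕ) : 𝓞 F)} ^ e) →
      ∀ Q : FreeRing (Fin r),
        (∀ k : Fin m, FreeRing.lift
          (fun j => ResGLnCohomology.heckeT (PadicAlgCl p) 2 F
            (𝔫 * Ideal.span {((p : ℕ) : 𝓞 F)} ^ e) (lams k) (qs k) (ix j).1 (ix j).2) Q = 0) →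
        ∀ idx ∈ J,
          (FreeRing.lift (fun j => 𝒰.heckeOperator (heckeElement 2 F (ix j).1 (ix j).2)) Q ^ N)
            idx = 0

end BigHeckeGLn

end Literature.NumberTheory.Automorphic
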